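/-
Copyright (c) 2026 the pub-hodgecm-mathlib formalisation cell (harness21).  Prover seat hodgecm-mathlib-K2E3-p06 (g4), Track B «K2-LIT», engine E3, unit U4 «Keys»; deal (D61)
LINE LEAD of the open leaf (U4f-χ₁-ram-one), design D-I v2, plan step Z2A-3 (5) «THE VANISHING FUNCTIONAL SEES ONLY `N̄ ∩ I`» — generic topological-group part; 2026-09-04.
KERNEL module: THEOREMS ONLY (no definition, no named fact, no `sorry`, no instance, no notation).
-/
import Mathlib.MeasureTheory.Integral.Bochner.Set
import Mathlib.MeasureTheory.Group.Measure
import Mathlib.Topology.Algebra.Group.Basic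
import Mathlib.Analysis.Complex.Basic
import HarnessLib

/-!
# K2 ∕ E3 «EllipticInputs», unit U4 «Keys» — (U4f-χ₁-ram-one) step Z2A-3 (5): THE INTERTWINING FUNCTIONAL OF A TYPE VECTOR IS `f′(1) · vol{n : w n w ∈ I} ≠ 0`
# «`F(w n w) = c` when `w n w ∈ I`, `= 0` otherwise ⟹ `∫_N F(w n w) dn = vol(S)·c`, `S` open ∋ 1, compact ⟹ `≠ 0` for `c ≠ 0`»   [Casselman1995 §6.4; Keys1984 §3]

Cell hodgecm-mathlib (D-0151), FLOOR 0, Track B «K2-LIT», engine E3, crux item H413 = stmt-HodgeConjecture-24833 (route `HCCMUnconditional`, no route verbs); target BY NAME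
the OPEN leaf `…K2E3EllipticInputs.U4Keys.sig_K2E3KeysThmTwoContractingRamifiedCharOne` (U4Keys ED. 7), design D-I v2, plan step Z2A (Branch A), generic part.  Author K2E3-p06 (g4),
line lead (D61).  `--supports stmt-HodgeConjecture-24833 --as helper`; THEOREMS ONLY.  NOT THE PAYER.

THE POINT.  Design D-I, Branch A, last step: the reducible principal series carries an `(I, χ̃)`-type vector `f′` in the kernel of the intertwining functional
`Λ_w(f′) = ∫_N f′(w n w) dn` (★ V1 `K2E3IntertwiningKernelOfReducible.exists_section_apply_one_ne_zero_forall_intertwiningIntegral_eq_zero` at `g = w`, ★ V2b, ★ Z2A-2);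
by ★ Z2-gen (`f′` vanishes on the cell `P·w·I`) and ★ Z2A-3a (`K2E3LowerUnipotentBorelIwahori`: a lower unipotent in `P·I` lies in `I`, one off `I` lies in `P·w·I`) the
integrand is `f′(1)` on `S = {n : w n w ∈ I}` and `0` off `S`.  THIS FILE is the purely topological-group ∕ measure-theoretic conclusion: `S` is open (`I` open), contains `1`
(`w² ∈ I`), and is compact (`N` closed, `I` compact), so `0 < vol(S) < ∞` for any measure positive on opens and finite on compacts (Haar), and `Λ_w(f′) = vol(S)·f′(1) ≠ 0`
— the contradiction that proves IRREDUCIBILITY in Branch A.  Any topological group `G`, subgroups `N`, `I`, element `w`, function `F : G → ℂ`.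
* §1 `isOpen_setOf_conj_mem`, `one_mem_setOf_conj_mem`, `isCompact_setOf_conj_mem` (the set `S`).
* §2 `integral_conj_eq_measureReal_mul` (`∫_N F(w n w) = vol(S)·c`).
* §3 **`integral_conj_ne_zero`** (`c ≠ 0` ⟹ `∫_N F(w n w) dn ≠ 0`), `integral_conj_ne_zero_of_isHaarMeasure`.
HONEST LABEL: HC_CM is proved only modulo the 7 printed citations (2 remaining named inputs: hLiu418 = stmt-HodgeConjecture-24832, h413 = stmt-HodgeConjecture-24833)
until rung 0 closes; count-neutral — this file does NOT pay the leaf; no printed citation is discharged.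

## References
* [Casselman1995] W. Casselman, *Introduction to the theory of admissible representations of `p`-adic reductive groups* (1995), §6.4 (the functionals `Λ_w` on `i(χ)` and their
  evaluation on vectors supported on one Bruhat–Iwahori cell).
* [Keys1984] D. Keys, *Principal series representations of special unitary groups over local fields*, Compositio Math. 51 (1984), §3 (intertwining operators and reducibility).
* [BruhatTits1972] F. Bruhat, J. Tits, Publ. Math. IHÉS 41 (1972), (4.4.4).
-/

set_option autoImplicit false
-- the mandated namespace has the single-problem summit's repeated segment (`HodgeConjecture.HodgeConjecture`)
set_option linter.dupNamespace false

noncomputable section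

open MeasureTheory
open scoped Topology

namespace Summit.HodgeConjecture.HodgeConjecture.Cruxes.H413.K2E3VanishingFunctionalLowerCell

variable {G : Type*} [Group G] [TopologicalSpace G] [IsTopologicalGroup G] (N I : Subgroup G) (w : G)

/-! ## §1 The set `S = {n ∈ N : w n w ∈ I}` -/

/-- `S = {n ∈ N : w n w ∈ I}` is OPEN in `N` when `I` is open. [cite: BruhatTits1972, (4.4.4)] -/
theorem isOpen_setOf_conj_mem (hI : IsOpen (I : Set G)) : IsOpen {n : ↥N | w * (n : G) * w ∈ I} :=
  hI.preimage (by fun_prop : Continuous fun n : ↥N => w * (n : G) * w)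

omit [TopologicalSpace G] [IsTopologicalGroup G] in
/-- `1 ∈ S` when `w² ∈ I` (e.g. `w² = 1`). [cite: BruhatTits1972, (4.4.4)] -/
theorem one_mem_setOf_conj_mem (hw : w * w ∈ I) : (1 : ↥N) ∈ {n : ↥N | w * (n : G) * w ∈ I} := by
  show w * ((1 : ↥N) : G) * w ∈ I
  rw [OneMemClass.coe_one, mul_one]; exact hw

/-- `S` is COMPACT when `N` is closed and `I` is compact (`S` is the preimage under the closed embedding `N ↪ G` of the compact set `w⁻¹ I w⁻¹`). [cite: BruhatTits1972, (4.4.4)] -/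
theorem isCompact_setOf_conj_mem (hN : IsClosed (N : Set G)) (hIc : IsCompact (I : Set G)) :
    IsCompact {n : ↥N | w * (n : G) * w ∈ I} := by
  have hc : IsCompact ((fun g : G => w * g * w) ⁻¹' (I : Set G)) :=
    ((Homeomorph.mulLeft w).trans (Homeomorph.mulRight w)).isCompact_preimage.2 hIc
  exact hN.isClosedEmbedding_subtypeVal.isCompact_preimage hc

/-! ## §2 The integral of a function constant on `w S w` and zero on `w (N ∖ S) w` -/

/-- **`∫_N F(w n w) dn = vol(S) · c`** when `F(w n w) = c` for `w n w ∈ I` and `F(w n w) = 0` otherwise (the integrand is `c · 𝟙_S`, `S` open hence measurable).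
[cite: Casselman1995, §6.4] -/
theorem integral_conj_eq_measureReal_mul [MeasurableSpace ↥N] [BorelSpace ↥N] (μ : Measure ↥N) (hI : IsOpen (I : Set G))
    (F : G → ℂ) (c : ℂ)
    (hin : ∀ n : ↥N, w * (n : G) * w ∈ I → F (w * (n : G) * w) = c)
    (hout : ∀ n : ↥N, w * (n : G) * w ∉ I → F (w * (n : G) * w) = 0) :
    ∫ n : ↥N, F (w * (n : G) * w) ∂μ = (μ.real {n : ↥N | w * (n : G) * w ∈ I} : ℂ) * c := by
  have hfun : (fun n : ↥N => F (w * (n : G) * w)) = {n : ↥N | w * (n : G) * w ∈ I}.indicator (fun _ => c) := by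
    funext n
    by_cases hn : w * (n : G) * w ∈ I
    · rw [Set.indicator_of_mem (show n ∈ {n : ↥N | w * (n : G) * w ∈ I} from hn), hin n hn]
    · rw [Set.indicator_of_notMem (show n ∉ {n : ↥N | w * (n : G) * w ∈ I} from hn), hout n hn]
  rw [hfun, integral_indicator_const c (isOpen_setOf_conj_mem N I w hI).measurableSet, Complex.real_smul]

/-! ## §3 Non-vanishing -/

/-- **THE VANISHING FUNCTIONAL DOES NOT VANISH**: if `N` is closed, `I` is compact open with `w² ∈ I`, `μ` is positive on opens and finite on compacts (e.g. a Haar measure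
on `N`), and `F(w n w) = c ≠ 0` for `w n w ∈ I`, `= 0` otherwise, then `∫_N F(w n w) dμ(n) = vol(S)·c ≠ 0` (`S ∋ 1` open ⟹ `vol S > 0`; `S` compact ⟹ `vol S < ∞`).
In design D-I Branch A this contradicts `Λ_w(f′) = 0` and proves irreducibility. [cite: Casselman1995, §6.4] [cite: Keys1984, §3] -/
theorem integral_conj_ne_zero [MeasurableSpace ↥N] [BorelSpace ↥N] (μ : Measure ↥N) [μ.IsOpenPosMeasure] [IsFiniteMeasureOnCompacts μ]
    (hN : IsClosed (N : Set G)) (hIo : IsOpen (I : Set G)) (hIc : IsCompact (I : Set G)) (hw : w * w ∈ I)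
    (F : G → ℂ) (c : ℂ) (hc : c ≠ 0)
    (hin : ∀ n : ↥N, w * (n : G) * w ∈ I → F (w * (n : G) * w) = c)
    (hout : ∀ n : ↥N, w * (n : G) * w ∉ I → F (w * (n : G) * w) = 0) :
    ∫ n : ↥N, F (w * (n : G) * w) ∂μ ≠ 0 := by
  rw [integral_conj_eq_measureReal_mul N I w μ hIo F c hin hout]
  refine mul_ne_zero ?_ hc
  rw [Complex.ofReal_ne_zero, measureReal_def]
  have hpos : 0 < μ {n : ↥N | w * (n : G) * w ∈ I} :=
    (isOpen_setOf_conj_mem N I w hIo).measure_pos μ ⟨1, one_mem_setOf_conj_mem N I w hw⟩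
  have hlt : μ {n : ↥N | w * (n : G) * w ∈ I} < ⊤ := (isCompact_setOf_conj_mem N I w hN hIc).measure_lt_top
  exact (ENNReal.toReal_pos hpos.ne' hlt.ne).ne'

/-- §3 for a HAAR measure on `N` (positive on opens, finite on compacts). [cite: Casselman1995, §6.4] [cite: Keys1984, §3] -/
theorem integral_conj_ne_zero_of_isHaarMeasure [MeasurableSpace ↥N] [BorelSpace ↥N] (μ : Measure ↥N) [μ.IsHaarMeasure]
    (hN : IsClosed (N : Set G)) (hIo : IsOpen (I : Set G)) (hIc : IsCompact (I : Set G)) (hw : w * w ∈ I)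
    (F : G → ℂ) (c : ℂ) (hc : c ≠ 0)
    (hin : ∀ n : ↥N, w * (n : G) * w ∈ I → F (w * (n : G) * w) = c)
    (hout : ∀ n : ↥N, w * (n : G) * w ∉ I → F (w * (n : G) * w) = 0) :
    ∫ n : ↥N, F (w * (n : G) * w) ∂μ ≠ 0 :=
  integral_conj_ne_zero N I w μ hN hIo hIc hw F c hc hin hout

end Summit.HodgeConjecture.HodgeConjecture.Cruxes.H413.K2E3VanishingFunctionalLowerCell

end
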